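import Summits.Ventures.LatticeQCDFlow.Scoring.SchwingerDysonWick
import HarnessLib

/-!
# `⟨M⁴⟩ = 3⟨M²⟩²` for every linear functional of the free lattice field: the fourth-moment (Binder) free-field check

HONEST FRAMING: exact (Metropolis-corrected) sampling algorithms for lattice gauge theory;
figures of merit are autocorrelation/cost numbers at stated couplings and volumes; no
continuum-physics claim.  (SCALAR calibration rung S0-A: not a gauge result.)

Venture `LatticeQCDFlow` (cell pub-lqcd), sub-topic `Scoring`; FANOUT row 2 (`s0-phi4`).  NEW WORK
of the cell.  Ninth file of the φ⁴ Schwinger–Dyson series: Wick's four-point theorem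
(`wick_four_point`, derived from Schwinger–Dyson alone in `SchwingerDysonWick.lean`) summed
against a linear functional `M = Σ_y m_y φ_y` (the magnetisation `m ≡ 1`, a Fourier mode
`m = cos θ`, …):

* `gibbs_linear_sq_of_coercive`, `gibbs_linear_fourth_of_coercive` — multilinearity:
  `⟨M²⟩ = Σ_{ab} m_a m_b ⟨φ_aφ_b⟩`, `⟨M⁴⟩ = Σ_{abcd} m_a m_b m_c m_d ⟨φ_aφ_bφ_cφ_d⟩` (any real `λ`,
  `J` under coercivity; all moments exist);
* `sum_three_pairings` — the pairing algebra
  `Σ_{abcd} m_a m_b m_c m_d (G_{ab}G_{cd} + G_{ac}G_{bd} + G_{ad}G_{bc})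
     = 3 (Σ_{ab} m_a m_b G_{ab})²`;
* **`wick_linear_fourth`** (`λ = 0`, `J + Jᵀ ≽ 2ε > 0`): **`⟨M⁴⟩ = 3 ⟨M²⟩²`** — equivalently the
  Binder cumulant `U = 1 − ⟨M⁴⟩/(3⟨M²⟩²)` of ANY linear functional vanishes EXACTLY for the
  Gaussian lattice measure, at every volume; `wick_linear_fourth_shift`: the engine's free field
  (latflow.core `phi4_2d`, `J = −Δ_lat + m²`, `m² > 0`, `λ = 0`) — a reference-free fourth-moment
  leg for the exactness battery's free-field check T1, typed.

NOT here: `λ > 0` corrections to the fourth moment (they follow from `gibbs_four_point_sd` but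
involve the six-point insertion); statistical power (numerics gate).
-/

namespace Summit.Ventures.LatticeQCDFlow.Scoring

open Real MeasureTheory Set Filter Finset

section WickLinear

variable {n : ℕ}

/-! ## Multilinearity of the moments of a linear functional -/

/-- **`⟨M²⟩ = Σ_{ab} m_a m_b ⟨φ_a φ_b⟩`** for `M = Σ_y m_y φ_y`, under coercivity. -/
theorem gibbs_linear_sq_of_coercive {J : Fin (n + 1) → Fin (n + 1) → ℝ} {lam ε K : ℝ}
    (hε : 0 < ε) (hS : ∀ φ : Fin (n + 1) → ℝ, ε * ∑ w, φ w ^ 2 - K ≤ latticePhi4Action J lam φ)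
    (m : Fin (n + 1) → ℝ) :
    gibbsExpect J lam (fun φ => (∑ y, m y * φ y) ^ 2)
      = ∑ a, ∑ b, m a * m b * gibbsExpect J lam (fun φ => φ a * φ b) := by
  have I : ∀ a b, Integrable (fun φ : Fin (n + 1) → ℝ =>
      m a * m b * (φ a * φ b) * gibbsWeight J lam φ) := by
    intro a b
    refine ((integrable_pow_mul_pow_mul_gibbsWeight_of_coercive hε hS a b 1 1).const_mul
      (m a * m b)).congr (Eventually.of_forall fun φ => ?_)
    simp only [pow_one]
    ring
  have e : (fun φ : Fin (n + 1) → ℝ => (∑ y, m y * φ y) ^ 2)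
      = fun φ => ∑ p : Fin (n + 1) × Fin (n + 1), m p.1 * m p.2 * (φ p.1 * φ p.2) := by
    funext φ
    rw [Fintype.sum_prod_type, sq, Finset.sum_mul_sum]
    exact Finset.sum_congr rfl fun a _ => Finset.sum_congr rfl fun b _ => by ring
  rw [e, gibbsExpect_sum J lam Finset.univ (fun p _ => I p.1 p.2), Fintype.sum_prod_type]
  simp only [gibbsExpect_const_mul]

/-- **`⟨M⁴⟩ = Σ_{abcd} m_a m_b m_c m_d ⟨φ_a φ_b φ_c φ_d⟩`** for `M = Σ_y m_y φ_y`, under coercivity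
(the quadruple sum indexed by `Λ × Λ × Λ × Λ`). -/
theorem gibbs_linear_fourth_of_coercive {J : Fin (n + 1) → Fin (n + 1) → ℝ} {lam ε K : ℝ}
    (hε : 0 < ε) (hS : ∀ φ : Fin (n + 1) → ℝ, ε * ∑ w, φ w ^ 2 - K ≤ latticePhi4Action J lam φ)
    (m : Fin (n + 1) → ℝ) :
    gibbsExpect J lam (fun φ => (∑ y, m y * φ y) ^ 4)
      = ∑ p : Fin (n + 1) × Fin (n + 1) × Fin (n + 1) × Fin (n + 1),
          m p.1 * m p.2.1 * m p.2.2.1 * m p.2.2.2 *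
            gibbsExpect J lam (fun φ => φ p.1 * φ p.2.1 * φ p.2.2.1 * φ p.2.2.2) := by
  have I : ∀ a b c d, Integrable (fun φ : Fin (n + 1) → ℝ =>
      m a * m b * m c * m d * (φ a * φ b * φ c * φ d) * gibbsWeight J lam φ) := by
    intro a b c d
    refine ((integrable_four_mul_gibbsWeight_of_coercive hε hS a b c d 1).const_mul
      (m a * m b * m c * m d)).congr (Eventually.of_forall fun φ => ?_)
    simp only [pow_one]
    ring
  have e : (fun φ : Fin (n + 1) → ℝ => (∑ y, m y * φ y) ^ 4)
      = fun φ => ∑ p : Fin (n + 1) × Fin (n + 1) × Fin (n + 1) × Fin (n + 1),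
          m p.1 * m p.2.1 * m p.2.2.1 * m p.2.2.2 * (φ p.1 * φ p.2.1 * φ p.2.2.1 * φ p.2.2.2) := by
    funext φ
    have h4 : (∑ y, m y * φ y) ^ 4
        = (∑ a, m a * φ a) * ((∑ b, m b * φ b) * ((∑ c, m c * φ c) * ∑ d, m d * φ d)) := by
      ring
    rw [h4, Finset.sum_mul_sum, Finset.sum_mul_sum, Finset.sum_mul_sum]
    simp only [Finset.mul_sum, Fintype.sum_prod_type]
    exact Finset.sum_congr rfl fun a _ => Finset.sum_congr rfl fun b _ =>
      Finset.sum_congr rfl fun c _ => Finset.sum_congr rfl fun d _ => by ring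
  rw [e, gibbsExpect_sum J lam Finset.univ (fun p _ => I p.1 p.2.1 p.2.2.1 p.2.2.2)]
  simp only [gibbsExpect_const_mul]

/-! ## The pairing algebra -/

/-- **Three pairings**: `Σ_{abcd} m_a m_b m_c m_d (G_{ab}G_{cd} + G_{ac}G_{bd} + G_{ad}G_{bc})
= 3 (Σ_{ab} m_a m_b G_{ab})²` (each pairing sum is the square, by relabelling the dummy indices). -/
theorem sum_three_pairings (m : Fin (n + 1) → ℝ) (G : Fin (n + 1) → Fin (n + 1) → ℝ) :
    ∑ p : Fin (n + 1) × Fin (n + 1) × Fin (n + 1) × Fin (n + 1),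
        m p.1 * m p.2.1 * m p.2.2.1 * m p.2.2.2 *
          (G p.1 p.2.1 * G p.2.2.1 p.2.2.2 + G p.1 p.2.2.1 * G p.2.1 p.2.2.2
            + G p.1 p.2.2.2 * G p.2.1 p.2.2.1)
      = 3 * (∑ a, ∑ b, m a * m b * G a b) ^ 2 := by
  -- the three pairing sums
  have split : ∑ p : Fin (n + 1) × Fin (n + 1) × Fin (n + 1) × Fin (n + 1),
        m p.1 * m p.2.1 * m p.2.2.1 * m p.2.2.2 *
          (G p.1 p.2.1 * G p.2.2.1 p.2.2.2 + G p.1 p.2.2.1 * G p.2.1 p.2.2.2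
            + G p.1 p.2.2.2 * G p.2.1 p.2.2.1)
      = (∑ p : Fin (n + 1) × Fin (n + 1) × Fin (n + 1) × Fin (n + 1),
          m p.1 * m p.2.1 * m p.2.2.1 * m p.2.2.2 * (G p.1 p.2.1 * G p.2.2.1 p.2.2.2))
        + (∑ p : Fin (n + 1) × Fin (n + 1) × Fin (n + 1) × Fin (n + 1),
          m p.1 * m p.2.1 * m p.2.2.1 * m p.2.2.2 * (G p.1 p.2.2.1 * G p.2.1 p.2.2.2))
        + ∑ p : Fin (n + 1) × Fin (n + 1) × Fin (n + 1) × Fin (n + 1),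
          m p.1 * m p.2.1 * m p.2.2.1 * m p.2.2.2 * (G p.1 p.2.2.2 * G p.2.1 p.2.2.1) := by
    rw [← Finset.sum_add_distrib, ← Finset.sum_add_distrib]
    exact Finset.sum_congr rfl fun p _ => by ring
  -- second pairing = first pairing, relabelling (a,b,c,d) ↦ (a,c,b,d)
  have h2 : ∑ p : Fin (n + 1) × Fin (n + 1) × Fin (n + 1) × Fin (n + 1),
        m p.1 * m p.2.1 * m p.2.2.1 * m p.2.2.2 * (G p.1 p.2.2.1 * G p.2.1 p.2.2.2)
      = ∑ p : Fin (n + 1) × Fin (n + 1) × Fin (n + 1) × Fin (n + 1),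
        m p.1 * m p.2.1 * m p.2.2.1 * m p.2.2.2 * (G p.1 p.2.1 * G p.2.2.1 p.2.2.2) := by
    rw [← Equiv.sum_comp
      (⟨fun p => (p.1, p.2.2.1, p.2.1, p.2.2.2), fun p => (p.1, p.2.2.1, p.2.1, p.2.2.2),
        fun _ => rfl, fun _ => rfl⟩ :
        (Fin (n + 1) × Fin (n + 1) × Fin (n + 1) × Fin (n + 1))
          ≃ (Fin (n + 1) × Fin (n + 1) × Fin (n + 1) × Fin (n + 1)))
      (fun p => m p.1 * m p.2.1 * m p.2.2.1 * m p.2.2.2 * (G p.1 p.2.1 * G p.2.2.1 p.2.2.2))]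
    exact Finset.sum_congr rfl fun p _ => by simp only [Equiv.coe_fn_mk]; ring
  -- third pairing = first pairing, relabelling (a,b,c,d) ↦ (a,d,b,c)
  have h3 : ∑ p : Fin (n + 1) × Fin (n + 1) × Fin (n + 1) × Fin (n + 1),
        m p.1 * m p.2.1 * m p.2.2.1 * m p.2.2.2 * (G p.1 p.2.2.2 * G p.2.1 p.2.2.1)
      = ∑ p : Fin (n + 1) × Fin (n + 1) × Fin (n + 1) × Fin (n + 1),
        m p.1 * m p.2.1 * m p.2.2.1 * m p.2.2.2 * (G p.1 p.2.1 * G p.2.2.1 p.2.2.2) := by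
    rw [← Equiv.sum_comp
      (⟨fun p => (p.1, p.2.2.2, p.2.1, p.2.2.1), fun p => (p.1, p.2.2.1, p.2.2.2, p.2.1),
        fun _ => rfl, fun _ => rfl⟩ :
        (Fin (n + 1) × Fin (n + 1) × Fin (n + 1) × Fin (n + 1))
          ≃ (Fin (n + 1) × Fin (n + 1) × Fin (n + 1) × Fin (n + 1)))
      (fun p => m p.1 * m p.2.1 * m p.2.2.1 * m p.2.2.2 * (G p.1 p.2.1 * G p.2.2.1 p.2.2.2))]
    exact Finset.sum_congr rfl fun p _ => by simp only [Equiv.coe_fn_mk]; ring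
  -- first pairing = the square
  have hQ : (∑ a, ∑ b, m a * m b * G a b) ^ 2
      = ∑ p : Fin (n + 1) × Fin (n + 1) × Fin (n + 1) × Fin (n + 1),
        m p.1 * m p.2.1 * m p.2.2.1 * m p.2.2.2 * (G p.1 p.2.1 * G p.2.2.1 p.2.2.2) := by
    rw [sq, Finset.sum_mul_sum, Fintype.sum_prod_type]
    simp only [Finset.sum_mul_sum, Fintype.sum_prod_type]
    refine Finset.sum_congr rfl fun a _ => ?_
    rw [Finset.sum_comm]
    exact Finset.sum_congr rfl fun b _ => Finset.sum_congr rfl fun c _ =>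
      Finset.sum_congr rfl fun d _ => by ring
  rw [split, h2, h3, ← hQ]
  ring

/-! ## The fourth moment of a linear functional of the free field -/

/-- **`⟨M⁴⟩ = 3⟨M²⟩²` for the Gaussian lattice measure** (`λ = 0`, `J + Jᵀ ≽ 2ε > 0`) and every
linear functional `M = Σ_y m_y φ_y`: the Binder cumulant `1 − ⟨M⁴⟩/(3⟨M²⟩²)` vanishes exactly, at
every volume.  From Wick's theorem (`wick_four_point`), itself from Schwinger–Dyson alone. -/
theorem wick_linear_fourth {J : Fin (n + 1) → Fin (n + 1) → ℝ} {ε : ℝ} (hε : 0 < ε)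
    (hJ : ∀ φ : Fin (n + 1) → ℝ, ε * ∑ w, φ w ^ 2 ≤ ∑ x, ∑ y, φ x * J x y * φ y)
    (m : Fin (n + 1) → ℝ) :
    gibbsExpect J 0 (fun φ => (∑ y, m y * φ y) ^ 4)
      = 3 * gibbsExpect J 0 (fun φ => (∑ y, m y * φ y) ^ 2) ^ 2 := by
  have hS := latticePhi4Action_coercive_of_quadForm_ge (J := J) le_rfl hJ
  rw [gibbs_linear_fourth_of_coercive hε hS m, gibbs_linear_sq_of_coercive hε hS m]
  simp only [wick_four_point hε hJ]
  exact sum_three_pairings m (fun a b => gibbsExpect J 0 (fun φ => φ a * φ b))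

/-- **The engine's free field** (`J = −Δ_lat + m²` via shift bijections, `m² > 0`, `λ = 0`):
`⟨M⁴⟩ = 3⟨M²⟩²` for every linear functional `M` — e.g. the magnetisation `Σ_x φ_x` and the
Fourier modes `Σ_x cos(θ_x) φ_x` of the exactness battery's free-field leg. -/
theorem wick_linear_fourth_shift {ι : Type*} [Fintype ι] (σ : ι → Equiv.Perm (Fin (n + 1)))
    {m2 : ℝ} (hm2 : 0 < m2) (m : Fin (n + 1) → ℝ) :
    gibbsExpect (shiftCoupling σ m2) 0 (fun φ => (∑ y, m y * φ y) ^ 4)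
      = 3 * gibbsExpect (shiftCoupling σ m2) 0 (fun φ => (∑ y, m y * φ y) ^ 2) ^ 2 :=
  wick_linear_fourth hm2 (shiftCoupling_quadForm_ge σ m2) m

end WickLinear

end Summit.Ventures.LatticeQCDFlow.Scoring
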